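import Literature.AlgebraicGeometry.Frobenioids.ArchimedeanPreModelType
import Literature.AlgebraicGeometry.Frobenioids.ArchimedeanBiratNormalized
import Literature.AlgebraicGeometry.Frobenioids.ArchimedeanFrobeniusIsotropic
import Literature.AlgebraicGeometry.Frobenioids.PerfectionModelTypeUnconditional
import Literature.AlgebraicGeometry.Frobenioids.Thm36Sub
import HarnessLib

/-!
# Frobenioids II, Theorem 3.6 (i): the archimedean Frobenioid `C = C^ℤ` and its perfection `C^ℚ = C^pf`
# are of MODEL type ([FrdI] Def. 4.5 (i)) — assembly (proof-only)

Mochizuki, *The geometry of Frobenioids II: poly-Frobenioids*, Kyushu J. Math. **62** (2008)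
401–460, §3, Theorem 3.6 (i), kurims text p. 36 ll. 34–35 [cite: MochizukiFrdII2008, Thm 3.6 (i) p.36]:
"The Frobenioid `(C^Λ)^istr` is of isotropic, base-trivial, and model type, with rational function monoid
naturally isomorphic to `(Φ^fld)^Λ`"; proof p. 38 l. 15: "it is immediate from the construction of `C^Λ`
that `C^Λ` is of … birationally Frobenius-normalized type".  [FrdI] Def. 4.5 (i) p. 86: *model type* =
pre-model type (Def. 2.7 (iii)) AND every object birationally Frobenius-normalized
[cite: MochizukiFrdI2008, Def. 4.5(i) p.86].

PROOF-ONLY file (abc-iut cell, layer L1, row M13-c3 piece P1 of HOME/staging/L1/L1-t6/g3/M13-c3-DESIGN.md;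
seat abc-iut-L1-t6).  Assembly BY NAME of
* the pre-model half `ArchFrd.C.isOfPreModelType π` (`ArchimedeanPreModelType.lean`, this seat: the
  base-Frobenius pair of standard unit discs), and
* the birationally-Frobenius-normalized half `ArchFrd.C.isBiratFrobeniusNormalized π hF hsq`
  (`ArchimedeanBiratNormalized.lean`, seat abc-iut-L1-t9),
into the [FrdI] Def. 4.5 (i) declaration consumed by [FrdI] Thm. 5.2 (iv) (`PreFrobenioid.IsOfModelType`):
* `ArchFrd.C.isOfModelType π hF hsq` — **`C` is of model type** (for any base over which `C` is a Frobenioid,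
  e.g. every connected totally epimorphic `D` by `Ex33ii_isFrobenioid_holds`), and, by [FrdI] Prop. 5.5 (iii)
  for perfections (abc-iut-w4-d108's `PreFrobenioid.Perfection.isOfModelType_perfection_of_isFrobeniusIsotropic'`,
  fed by Ex. 3.3 (ii) "`C` is of Frobenius-isotropic type" = `Ex33ii_frobeniusIsotropic_holds`),
* `ArchFrd.Thm36Sub.pf_isOfModelType π hF` — **`C^ℚ = C^pf` (THE perfection, `Thm36Sub.pfStr π hF`) is of
  model type** at THE birationalization of `C^pf` — the "model type" clause of Thm. 3.6 (i) at `Λ = ℚ` in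
  its Def. 4.5 (i) form (the remaining content of that clause, "rational function monoid ≅ (Φ^fld)^ℚ" and the
  equivalence with the model Frobenioid via Thm. 5.2 (iv), are pieces P2–P4 of the design).
[FrdI]/[FrdII] §3 are classical; nothing here takes a side on [IUTchIII] Cor. 3.12.  No definitions.
-/

noncomputable section

namespace Literature.AlgebraicGeometry.Frobenioids

open CategoryTheory Opposite

namespace ArchFrd

universe v u

variable {D : Type u} [Category.{v} D] (π : D ⥤ D0)

/-- **The archimedean Frobenioid `C` is of model type** ([FrdI] Def. 4.5 (i): pre-model AND birationally
Frobenius-normalized), at THE birationalization, for any square-completion witness `hsq`.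
[cite: MochizukiFrdII2008, Thm 3.6 (i) p.36] -/
theorem C.isOfModelType (hF : PreFrobenioid.IsFrobenioid (C.toElem π))
    (hsq : PreFrobenioid.HasBiratSquares (C.toElem π)) :
    PreFrobenioid.IsOfModelType (C.toElem π) hF hsq :=
  ⟨C.isOfPreModelType π, C.isBiratFrobeniusNormalized π hF hsq⟩

/-- The same at THE square-completion witness of [FrdI] Prop. 1.11 (vii) (`hasBiratSquares_of_isFrobenioid`).
[cite: MochizukiFrdII2008, Thm 3.6 (i) p.36] -/
theorem C.isOfModelType' (hF : PreFrobenioid.IsFrobenioid (C.toElem π)) :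
    PreFrobenioid.IsOfModelType (C.toElem π) hF (PreFrobenioid.hasBiratSquares_of_isFrobenioid hF) :=
  C.isOfModelType π hF _

/-- Over a connected, totally epimorphic base (Ex. 3.3 (i)'s standing hypotheses, under which `C` is a
Frobenioid by `Ex33ii_isFrobenioid_holds`): `C` is of model type — no binder left.
[cite: MochizukiFrdII2008, Thm 3.6 (i) p.36] -/
theorem C.isOfModelType_of_base (hDc : IsGraphConnected D) (hDe : IsTotallyEpimorphic D) :
    PreFrobenioid.IsOfModelType (C.toElem π) (Ex33ii_isFrobenioid_holds π hDc hDe)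
      (PreFrobenioid.hasBiratSquares_of_isFrobenioid (Ex33ii_isFrobenioid_holds π hDc hDe)) :=
  C.isOfModelType' π _

namespace Thm36Sub

/-- The Frobenioid structure on THE perfection used below: [FrdI] Prop. 3.2 (iii) (`Perfection.isFrobenioid`)
fed by Ex. 3.3 (ii) "`C` is of Frobenius-isotropic type". [cite: MochizukiFrdII2008, Ex 3.3 (ii) p.28] -/
theorem pf_isFrobenioid (hF : PreFrobenioid.IsFrobenioid (C.toElem π)) :
    PreFrobenioid.IsFrobenioid (pfStr π hF) :=
  PreFrobenioid.Perfection.isFrobenioid hF (Ex33ii_frobeniusIsotropic_holds π)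

/-- **Thm. 3.6 (i), "model type", `Λ = ℚ`, Def. 4.5 (i) form**: THE perfection `C^ℚ = C^pf` of the
archimedean Frobenioid is of model type (pre-model and birationally Frobenius-normalized at THE
birationalization of `C^pf`), by [FrdI] Prop. 5.5 (iii) for perfections applied to `C.isOfModelType'`.
[cite: MochizukiFrdII2008, Thm 3.6 (i) p.36] -/
theorem pf_isOfModelType (hF : PreFrobenioid.IsFrobenioid (C.toElem π)) :
    PreFrobenioid.IsOfModelType (pfStr π hF) (pf_isFrobenioid π hF)
      (PreFrobenioid.hasBiratSquares_of_isFrobenioid (pf_isFrobenioid π hF)) :=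
  PreFrobenioid.Perfection.isOfModelType_perfection_of_isFrobeniusIsotropic' hF
    (Ex33ii_frobeniusIsotropic_holds π) (C.isOfModelType' π hF)

/-- The pre-model half alone for `C^pf` ([FrdI] Def. 2.7 (iii)), any Frobenioid structure witness.
[cite: MochizukiFrdII2008, Thm 3.6 (i) p.36] -/
theorem pf_isOfPreModelType (hF : PreFrobenioid.IsFrobenioid (C.toElem π)) :
    PreFrobenioid.IsOfPreModelType (pfStr π hF) :=
  (pf_isOfModelType π hF).1

end Thm36Sub

end ArchFrd

end Literature.AlgebraicGeometry.Frobenioids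

end
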